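/-
Copyright (c) 2026 the pub-hodgecm-mathlib formalisation cell (harness21).  Prover seat hodgecm-mathlib-K2E3-p12 (g8), Track B ∕ K2-LIT, h413 = `stmt-HodgeConjecture-24833`,
line `K2_E1_TraceFormulaBeta`, 5Res ROADCARD (154)∕(260): a `χ`-section is DETERMINED BY ITS RESTRICTION TO `K_U` (Iwasawa `G = B·K_U`), and a continuous one vanishing `μ_K`-a.e. on `K_U`
vanishes identically — the well-definedness input for descending section-valued sesquilinear data (★ H-c∕VectorGram's `B_z(φ,φ′)`) to the `L²(K_U)`-classes `v_a` of the `hSD` letter.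
-/
import Summits.HodgeConjecture.HodgeConjecture.Theorems.K2E1CharacterEisensteinU2Defs          -- ★ `IsChiSection`, `firstEntryUnit`
import Literature.NumberTheory.Automorphic.UnitaryGroupIwasawaAdelic                      -- ★ `exists_mem_borelAdelic_mul_mem_standardMaximalCompactGL_cm`
import HarnessLib

/-!
# `K2E1ChiSectionDeterminedByMaximalCompactU2`: `χ`-SECTIONS ARE DETERMINED ON `K_U`; CONTINUOUS ONES VANISHING a.e. ON `K_U` VANISH

Track B ∕ K2-LIT, crux h413 = `stmt-HodgeConjecture-24833`, route of record `HCCMUnconditional`; cell `hodgecm-mathlib`, squad K2, ENGINE E1.  THEOREMS ONLY (no `def`, no `instance`,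
no `notation`, no named-fact hypothesis, no `sorry`); lane `--supports stmt-HodgeConjecture-24833 --as helper` (count-neutral).
THE MATHEMATICS ([MoeglinWaldspurger1995, I.2.17, II.1.7]; [Rogawski1990, §2.2]).  With the Iwasawa decomposition `G(𝔸) = B(𝔸)·K_U` (letter `hBK` in general; ★ for the CM quasi-split
unitary group, `exists_mem_borelAdelic_mul_mem_standardMaximalCompactGL_cm`), a `χ`-section (`φ(bg) = χ(b₀₀)φ(g)`) is determined by `φ|_{K_U}` (§1 `eq_of_eqOn_maximalCompact`,
`eq_zero_of_forall_maximalCompact`); and since a Haar measure on the compact group `K_U` charges every open set, a CONTINUOUS `χ`-section that vanishes `μ_K`-a.e. on `K_U` vanishes on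
`K_U` (Mathlib `Continuous.ae_eq_iff_eq`), hence everywhere (§2 `eq_zero_of_ae_eq_zero_maximalCompact`, CM edition `…_cm`).  Consequence: sesquilinear data in continuous `χ`-sections
(e.g. `B_z(φ,φ′) = (ν𝓕)⁻¹∫_{K_U} φ·conj I_{φ′}(z̄,·)`, ★ `K2E1ChiPseudoEisensteinSelfDualVectorGramCMTwo`) DESCENDS to the `L²(K_U, μ_K)`-classes of the sections (the `v_a` of the `hSD`
letter of ★ `K2E1ChiSectionPlancherelSelfDualCMTwo`): equal classes ⇒ equal sections.
* §1 `eq_of_eqOn_maximalCompact`, `eq_zero_of_forall_maximalCompact`.  * §2 **`eq_zero_of_ae_eq_zero_maximalCompact`**, **`eq_of_ae_eq_maximalCompact`**, CM editions `…_cm`.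
HONEST LABEL: HC_CM is proved only modulo the 7 printed citations (2 remaining named inputs: hLiu418 = `stmt-HodgeConjecture-24832`, h413 = `stmt-HodgeConjecture-24833`) until rung 0
closes; this file asserts no named fact, closes no socket; count-neutral; letter-free.

## References
* [MoeglinWaldspurger1995] C. Mœglin, J.-L. Waldspurger, *Spectral decomposition and Eisenstein series* (1995), I.2.17, II.1.7.
* [Rogawski1990] J. D. Rogawski, *Automorphic Representations of Unitary Groups in Three Variables* (1990), §2.2.
-/

set_option autoImplicit false
set_option linter.dupNamespace false  -- the mandated namespace repeats the summit's segment (`HodgeConjecture.HodgeConjecture`)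

noncomputable section

open MeasureTheory Measure NumberField
open scoped ENNReal NNReal
open Literature.NumberTheory Literature.NumberTheory.Automorphic Literature.NumberTheory.Automorphic.UnitaryGroup AdelicGroupData
open Literature.NumberTheory.GaloisRepresentations (HeckeCharacter)
open Summit.HodgeConjecture.HodgeConjecture.Cruxes.H413.K2E1CharacterEisensteinU2Defs

namespace Summit.HodgeConjecture.HodgeConjecture.Cruxes.H413.K2E1ChiSectionDeterminedByMaximalCompactU2

/-! ## §1 A `χ`-section is determined by its restriction to `K_U` (Iwasawa letter `hBK`) -/

section Generic

variable {F E : Type} [Field F] [NumberField F] [Field E] [NumberField E] [Algebra F E] {c : E ≃ₐ[F] E} {N : ℕ} [NeZero N]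

/-- **`φ|_{K_U} = ψ|_{K_U} ⇒ φ = ψ`** for `χ`-sections `φ, ψ`, given the Iwasawa decomposition `g = b·k` (`hBK`). [cite: MoeglinWaldspurger1995, I.2.17] -/
theorem eq_of_eqOn_maximalCompact
    (hBK : ∀ g : (quasiSplit F E c N).Adelic, ∃ b ∈ borelAdelic F E c N, ∃ k : (quasiSplit F E c N).Adelic, adelicVal F E c N ((StdForm.antidiagonal N).over E) k ∈ standardMaximalCompactGL N E ∧ g = b * k)
    {χ : HeckeCharacter E} {φ ψ : (quasiSplit F E c N).Adelic → ℂ} (hφ : IsChiSection χ φ) (hψ : IsChiSection χ ψ)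
    (h : ∀ k : (quasiSplit F E c N).Adelic, adelicVal F E c N ((StdForm.antidiagonal N).over E) k ∈ standardMaximalCompactGL N E → φ k = ψ k) : φ = ψ := by
  funext g
  obtain ⟨b, hb, k, hk, rfl⟩ := hBK g
  rw [hφ.borel_mul hb, hψ.borel_mul hb, h k hk]

/-- **`φ|_{K_U} = 0 ⇒ φ = 0`** for a `χ`-section. [cite: MoeglinWaldspurger1995, I.2.17] -/
theorem eq_zero_of_forall_maximalCompact
    (hBK : ∀ g : (quasiSplit F E c N).Adelic, ∃ b ∈ borelAdelic F E c N, ∃ k : (quasiSplit F E c N).Adelic, adelicVal F E c N ((StdForm.antidiagonal N).over E) k ∈ standardMaximalCompactGL N E ∧ g = b * k)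
    {χ : HeckeCharacter E} {φ : (quasiSplit F E c N).Adelic → ℂ} (hφ : IsChiSection χ φ)
    (h : ∀ k : (quasiSplit F E c N).Adelic, adelicVal F E c N ((StdForm.antidiagonal N).over E) k ∈ standardMaximalCompactGL N E → φ k = 0) : φ = 0 :=
  eq_of_eqOn_maximalCompact hBK hφ (IsChiSection.zero χ) fun k hk => by rw [h k hk]; rfl

/-! ## §2 Continuous `χ`-sections vanishing `μ_K`-a.e. on `K_U` vanish -/

variable [MeasurableSpace (quasiSplit F E c N).Adelic]

/-- **A continuous `χ`-section vanishing `μ_K`-a.e. on `K_U` vanishes identically** (`μ_K` positive on open sets of `K_U`, e.g. a Haar measure; Mathlib `Continuous.ae_eq_iff_eq`; then §1).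
[cite: MoeglinWaldspurger1995, I.2.17] -/
theorem eq_zero_of_ae_eq_zero_maximalCompact
    (hBK : ∀ g : (quasiSplit F E c N).Adelic, ∃ b ∈ borelAdelic F E c N, ∃ k : (quasiSplit F E c N).Adelic, adelicVal F E c N ((StdForm.antidiagonal N).over E) k ∈ standardMaximalCompactGL N E ∧ g = b * k)
    (μK : Measure ((standardMaximalCompactGL N E).comap (adelicVal F E c N ((StdForm.antidiagonal N).over E)) : Subgroup (quasiSplit F E c N).Adelic)) [μK.IsOpenPosMeasure]
    {χ : HeckeCharacter E} {φ : (quasiSplit F E c N).Adelic → ℂ} (hφ : IsChiSection χ φ) (hφc : Continuous φ)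
    (h : (fun k : ((standardMaximalCompactGL N E).comap (adelicVal F E c N ((StdForm.antidiagonal N).over E)) : Subgroup (quasiSplit F E c N).Adelic) => φ (k : (quasiSplit F E c N).Adelic)) =ᵐ[μK] 0) :
    φ = 0 := by
  have h0 : (fun k : ((standardMaximalCompactGL N E).comap (adelicVal F E c N ((StdForm.antidiagonal N).over E)) : Subgroup (quasiSplit F E c N).Adelic) => φ (k : (quasiSplit F E c N).Adelic)) = 0 :=
    (Continuous.ae_eq_iff_eq μK (hφc.comp continuous_subtype_val) continuous_const).1 h
  exact eq_zero_of_forall_maximalCompact hBK hφ fun k hk => by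
    have := congrFun h0 ⟨k, hk⟩
    simpa using this

/-- **Two continuous `χ`-sections that agree `μ_K`-a.e. on `K_U` are equal** — so sesquilinear data in continuous `χ`-sections descends to their `L²(K_U, μ_K)`-classes. [cite: MoeglinWaldspurger1995, I.2.17] -/
theorem eq_of_ae_eq_maximalCompact
    (hBK : ∀ g : (quasiSplit F E c N).Adelic, ∃ b ∈ borelAdelic F E c N, ∃ k : (quasiSplit F E c N).Adelic, adelicVal F E c N ((StdForm.antidiagonal N).over E) k ∈ standardMaximalCompactGL N E ∧ g = b * k)
    (μK : Measure ((standardMaximalCompactGL N E).comap (adelicVal F E c N ((StdForm.antidiagonal N).over E)) : Subgroup (quasiSplit F E c N).Adelic)) [μK.IsOpenPosMeasure]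
    {χ : HeckeCharacter E} {φ ψ : (quasiSplit F E c N).Adelic → ℂ} (hφ : IsChiSection χ φ) (hφc : Continuous φ) (hψ : IsChiSection χ ψ) (hψc : Continuous ψ)
    (h : (fun k : ((standardMaximalCompactGL N E).comap (adelicVal F E c N ((StdForm.antidiagonal N).over E)) : Subgroup (quasiSplit F E c N).Adelic) => φ (k : (quasiSplit F E c N).Adelic)) =ᵐ[μK]
      fun k => ψ (k : (quasiSplit F E c N).Adelic)) : φ = ψ := by
  have hsub : IsChiSection χ (φ - ψ) := by
    have h1 := hφ.add (hψ.smul (-1))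
    simpa [sub_eq_add_neg] using h1
  have hz := eq_zero_of_ae_eq_zero_maximalCompact hBK μK hsub (hφc.sub hψc) (by
    filter_upwards [h] with k hk
    simp [hk])
  exact sub_eq_zero.1 hz

end Generic

/-! ## §3 CM editions (Iwasawa ★ for the CM quasi-split unitary group) -/

section CM

variable (L : Type) [Field L] [NumberField L] [IsCMField L] {N : ℕ} [NeZero N]
variable [MeasurableSpace (quasiSplit (↥(maximalRealSubfield L)) L (IsCMField.complexConj L) N).Adelic]

/-- **CM edition**: a continuous `χ`-section of `U(J_N)_{L∕L⁺}` vanishing `μ_K`-a.e. on `K_U` vanishes (★ Iwasawa `exists_mem_borelAdelic_mul_mem_standardMaximalCompactGL_cm`). [cite: MoeglinWaldspurger1995, I.2.17] -/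
theorem eq_zero_of_ae_eq_zero_maximalCompact_cm
    (μK : Measure ((standardMaximalCompactGL N L).comap (adelicVal (↥(maximalRealSubfield L)) L (IsCMField.complexConj L) N ((StdForm.antidiagonal N).over L)) : Subgroup (quasiSplit (↥(maximalRealSubfield L)) L (IsCMField.complexConj L) N).Adelic))
    [μK.IsOpenPosMeasure]
    {χ : HeckeCharacter L} {φ : (quasiSplit (↥(maximalRealSubfield L)) L (IsCMField.complexConj L) N).Adelic → ℂ} (hφ : IsChiSection χ φ) (hφc : Continuous φ)
    (h : (fun k : ((standardMaximalCompactGL N L).comap (adelicVal (↥(maximalRealSubfield L)) L (IsCMField.complexConj L) N ((StdForm.antidiagonal N).over L)) : Subgroup (quasiSplit (↥(maximalRealSubfield L)) L (IsCMField.complexConj L) N).Adelic) =>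
      φ (k : (quasiSplit (↥(maximalRealSubfield L)) L (IsCMField.complexConj L) N).Adelic)) =ᵐ[μK] 0) :
    φ = 0 :=
  eq_zero_of_ae_eq_zero_maximalCompact (exists_mem_borelAdelic_mul_mem_standardMaximalCompactGL_cm L (N := N)) μK hφ hφc h

/-- **CM edition**: continuous `χ`-sections of `U(J_N)_{L∕L⁺}` that agree `μ_K`-a.e. on `K_U` are equal. [cite: MoeglinWaldspurger1995, I.2.17] -/
theorem eq_of_ae_eq_maximalCompact_cm
    (μK : Measure ((standardMaximalCompactGL N L).comap (adelicVal (↥(maximalRealSubfield L)) L (IsCMField.complexConj L) N ((StdForm.antidiagonal N).over L)) : Subgroup (quasiSplit (↥(maximalRealSubfield L)) L (IsCMField.complexConj L) N).Adelic))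
    [μK.IsOpenPosMeasure]
    {χ : HeckeCharacter L} {φ ψ : (quasiSplit (↥(maximalRealSubfield L)) L (IsCMField.complexConj L) N).Adelic → ℂ} (hφ : IsChiSection χ φ) (hφc : Continuous φ) (hψ : IsChiSection χ ψ) (hψc : Continuous ψ)
    (h : (fun k : ((standardMaximalCompactGL N L).comap (adelicVal (↥(maximalRealSubfield L)) L (IsCMField.complexConj L) N ((StdForm.antidiagonal N).over L)) : Subgroup (quasiSplit (↥(maximalRealSubfield L)) L (IsCMField.complexConj L) N).Adelic) =>
      φ (k : (quasiSplit (↥(maximalRealSubfield L)) L (IsCMField.complexConj L) N).Adelic)) =ᵐ[μK]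
      fun k => ψ (k : (quasiSplit (↥(maximalRealSubfield L)) L (IsCMField.complexConj L) N).Adelic)) : φ = ψ :=
  eq_of_ae_eq_maximalCompact (exists_mem_borelAdelic_mul_mem_standardMaximalCompactGL_cm L (N := N)) μK hφ hφc hψ hψc h

end CM

end Summit.HodgeConjecture.HodgeConjecture.Cruxes.H413.K2E1ChiSectionDeterminedByMaximalCompactU2

end
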